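import Summits.Ventures.PercRepro.SixFourPLProfileB
import Summits.Ventures.PercRepro.SixFourPLPlanes
import Summits.Ventures.PercRepro.SixFourPLSeam

/-!
# PercRepro — C-025 at `(6,4)`, step (4) of `PLJlow` ON THE MATROID SIDE: the bridge `PLData → PLTraceData` and
`Xcnt M G ≤ X̄(profile D)` (mine-2 g21; the five bridge terms of lead (kp)(1) / (ku)(2))

`SixFourPLSeam` proves `Xcnt M G ≤ PL.Xbar π` from abstract hypotheses — `hGeq : G = ρ ∪ L`, `h : PLTraceData π ρ L C N`,
`hinj` (injectivity of `P ↦ P ∩ G` on the rank-3-trace planes) and `hsub` (their traces lie in the list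
`{ρ} ∪ {L ∪ λ_j} ∪ {{x} ∪ λ}`). This file supplies them for every plane-line normalisation `D : PLData M G`
(`simple M`, `G ⊆ E`, plane traces `≤ 7`, `10 ≤ g`) from p3's `PLData` facts:

* `PLData.lineTraces` — the non-class line traces of `ρ`: `L′ ∩ ρ` for `L′ ∈ lines M`, `≥ 2` points, not a class;
* `PLData.traceData : PLTraceData D.profile D.ρ D.L D.classes D.lineTraces` — the twelve fields: `disj`, `p_eq`, `n_eq`
  (by `rfl`), `three_le` (`three_le_card_L`), `sizes_eq` (`Multiset.sort_eq`), `class_subset`, `line_subset`,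
  `class_line` / `line_line` (two lines through two common points coincide, `lines_eq_of_two_mem` + `class_line`),
  `class_class` (`classes_inter_subset` + `mem_lam_of_mem_ellF`, so `A ∩ B = ℓ ∩ ρ`, of size `e` by `e_profile_eq`),
  `cap` (`s_j ≤ 7 − n` and `p + n ≥ 10` from `constraints_profile`), `nu_pos` (the injection `C ↦ cl(C)` of
  `card_classes_le_inc` misses the non-class line, so `inc_m > #{j : s_j = m}`);
* `PLData.injOn_planes3` (`hinj`, from `plane_eq_clF_trace`), `PLData.Pi_inter_G_eq` (`Π_y ∩ G = L ∪ λ_y`),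
  `PLData.image_planes3_subset_tracesOf` (`hsub`, from `plane_trichotomy`);
* `PLData.clF_lineTrace` (a non-class line trace determines its line) and **`PLData.card_lineTraces_le_nu`** —
  `#{l ∈ lineTraces : |l| = m} ≤ ν_m(profile D)` (classes and non-class traces of size `m` inject with disjoint
  images into the lines meeting `ρ` in `m` points), the count the `{x} ∪ λ` planes of the list need;
* **`PLData.Xcnt_le_Xbar_profile`** — `Xcnt M G ≤ PL.Xbar D.profile`, the composition `Xcnt_le_Xbar_seam`.

Imports `SixFourPLProfileB`, `SixFourPLPlanes` (p3) and `SixFourPLSeam` (the step-(4) seam).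
-/

namespace PercRepro.SixFour

open Finset ThmH

variable {α : Type*} [DecidableEq α] {M : Matroid α} [M.Finite] {G : Finset α}

namespace PLData

variable (D : PLData M G)

/-- The non-class line traces of `ρ`: traces `L′ ∩ ρ` of lines of `M` with `≥ 2` points that are not classes. -/
noncomputable def lineTraces : Finset (Finset α) :=
  ((lines M).image fun L' => L' ∩ D.ρ).filter fun l => 2 ≤ l.card ∧ l ∉ D.classes

variable {D}

/-- `ρ` and `L` are disjoint. -/
theorem disjoint_ρ_L : Disjoint D.ρ D.L := by
  unfold ρ L
  exact Finset.disjoint_left.2 fun y hy hy' => (Finset.mem_sdiff.1 hy').2 (Finset.mem_inter.1 hy).1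

/-- The bridge: the combinatorial data of the traces. -/
theorem traceData (hs : Simple M) (hG : G ⊆ gr M) (hpl : ∀ P ∈ planes M, (P ∩ G).card ≤ 7) (hg : 10 ≤ G.card) :
    PLTraceData D.profile D.ρ D.L D.classes D.lineTraces :=
  have h2 : 2 ≤ D.L.card := by have := D.three_le_card_L (hpl _ D.plane) hg; omega
  { 
  disj := disjoint_ρ_L
  p_eq := rfl
  n_eq := rfl
  three_le := D.three_le_card_L (hpl _ D.plane) hg
  sizes_eq := by
    simp only [profile, sizes, Multiset.coe_reverse, Multiset.sort_eq]
  class_subset := by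
    intro A hA
    obtain ⟨y, -, rfl⟩ := Finset.mem_image.1 hA
    exact Finset.inter_subset_right
  line_subset := by
    intro l hl
    obtain ⟨L', -, rfl⟩ := Finset.mem_image.1 (Finset.mem_filter.1 hl).1
    exact Finset.inter_subset_right
  class_line := by
    intro A hA l hl
    refine not_lt.1 fun hcon => ?_
    obtain ⟨a, ha, b, hb, hab⟩ := Finset.one_lt_card.1 hcon
    obtain ⟨hmem, -, hncl⟩ := Finset.mem_filter.1 hl
    obtain ⟨L', hL', rfl⟩ := Finset.mem_image.1 hmem
    obtain ⟨hAl, hAρ⟩ := class_line hs hG h2 hA (by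
      have := Finset.card_le_card (Finset.inter_subset_left : A ∩ (L' ∩ D.ρ) ⊆ A); omega)
    rw [Finset.mem_inter] at ha hb
    have haA : a ∈ clF M A := by have := ha.1; rw [← hAρ] at this; exact (Finset.mem_inter.1 this).1
    have hbA : b ∈ clF M A := by have := hb.1; rw [← hAρ] at this; exact (Finset.mem_inter.1 this).1
    have hLeq : clF M A = L' :=
      lines_eq_of_two_mem hs hAl hL' haA hbA (Finset.mem_inter.1 ha.2).1 (Finset.mem_inter.1 hb.2).1 hab
    have hlA : L' ∩ D.ρ = A := by rw [← hLeq]; exact hAρ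
    exact hncl (hlA ▸ hA)
  line_line := by
    intro l hl l' hl' hne
    refine not_lt.1 fun hcon => ?_
    obtain ⟨a, ha, b, hb, hab⟩ := Finset.one_lt_card.1 hcon
    obtain ⟨hmem, -, -⟩ := Finset.mem_filter.1 hl
    obtain ⟨L', hL', rfl⟩ := Finset.mem_image.1 hmem
    obtain ⟨hmem', -, -⟩ := Finset.mem_filter.1 hl'
    obtain ⟨L'', hL'', rfl⟩ := Finset.mem_image.1 hmem'
    rw [Finset.mem_inter] at ha hb
    have := lines_eq_of_two_mem hs hL' hL'' (Finset.mem_inter.1 ha.1).1 (Finset.mem_inter.1 hb.1).1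
      (Finset.mem_inter.1 ha.2).1 (Finset.mem_inter.1 hb.2).1 hab
    exact hne (by rw [this])
  class_class := by
    intro A hA B hB hne
    rw [e_profile_eq hs hG h2]
    congr 1
    refine Finset.Subset.antisymm (classes_inter_subset hs hG h2 hA hB hne) ?_
    intro z hz
    rw [Finset.mem_inter] at hz ⊢
    obtain ⟨y, -, rfl⟩ := Finset.mem_image.1 hA
    obtain ⟨y', -, rfl⟩ := Finset.mem_image.1 hB
    exact ⟨mem_lam_of_mem_ellF hz.1 hz.2, mem_lam_of_mem_ellF hz.1 hz.2⟩
  cap := by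
    intro A hA
    obtain ⟨-, -, -, hne6, hpn10, -, -, -, -, -, hsz, -, -⟩ := constraints_profile (D := D) hs hG hpl hg
    obtain ⟨y, hy, rfl⟩ := Finset.mem_image.1 hA
    have hmem : (D.lam y).card ∈ D.sizes := mem_sizes.2 ⟨y, hy, rfl⟩
    have h1 := hsz _ hmem
    have hp : D.profile.p = D.ρ.card := rfl
    have hn : D.profile.n = D.L.card := rfl
    omega
  nu_pos := by
    intro l hl
    obtain ⟨hmem, h2l, hncl⟩ := Finset.mem_filter.1 hl
    obtain ⟨L', hL', rfl⟩ := Finset.mem_image.1 hmem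
    have hm7 : (L' ∩ D.ρ).card ≤ 7 := (Finset.card_le_card Finset.inter_subset_right).trans (hpl _ D.plane)
    have hinc : PL.incOf D.profile (L' ∩ D.ρ).card = inc M D.ρ (L' ∩ D.ρ).card := by
      unfold PL.incOf
      rw [if_pos h2l, inc_profile _ (by omega)]
      congr 1
      omega
    have hcnt : D.profile.sizes.count (L' ∩ D.ρ).card =
        (D.classes.filter fun C => (L' ∩ D.ρ).card = C.card).card := sizes_count _
    show 0 < PL.incOf D.profile (L' ∩ D.ρ).card - D.profile.sizes.count (L' ∩ D.ρ).card
    rw [hinc, hcnt]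
    apply Nat.sub_pos_of_lt
    unfold inc
    have hinj : Set.InjOn (fun C => clF M C) ↑(D.classes.filter fun C => (L' ∩ D.ρ).card = C.card) := by
      intro C hC C' hC' heq
      rw [Finset.mem_coe, Finset.mem_filter] at hC hC'
      simp only at heq
      rw [← (class_line hs hG h2 hC.1 (by omega)).2, ← (class_line hs hG h2 hC'.1 (by omega)).2, heq]
    rw [← Finset.card_image_of_injOn hinj]
    apply Finset.card_lt_card
    refine ⟨?_, ?_⟩
    · intro X hX
      obtain ⟨C, hC, rfl⟩ := Finset.mem_image.1 hX
      rw [Finset.mem_filter] at hC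
      obtain ⟨hLc, htr⟩ := class_line hs hG h2 hC.1 (by omega)
      rw [Finset.mem_filter, htr]
      exact ⟨hLc, hC.2.symm⟩
    · intro hsub
      have hL'mem : L' ∈ (lines M).filter fun L : Finset α => (L ∩ D.ρ).card = (L' ∩ D.ρ).card :=
        Finset.mem_filter.2 ⟨hL', rfl⟩
      obtain ⟨C, hC, hCeq⟩ := Finset.mem_image.1 (hsub hL'mem)
      rw [Finset.mem_filter] at hC
      obtain ⟨-, htr⟩ := class_line hs hG h2 hC.1 (by omega)
      rw [← hCeq, htr] at hncl
      exact hncl hC.1 }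

/-- `G = ρ ∪ L`. -/
theorem ρ_union_L : D.ρ ∪ D.L = G := by
  unfold ρ L
  rw [Finset.inter_comm, Finset.union_comm, Finset.sdiff_union_inter]

/-- The bridge term `hinj`: on the rank-3-trace planes `P ↦ P ∩ G` is injective (`plane_eq_clF_trace`). -/
theorem injOn_planes3 : Set.InjOn (fun P : Finset α => P ∩ (D.ρ ∪ D.L)) (planes3 M G) := by
  intro P hP P' hP' heq
  rw [Finset.mem_coe, mem_planes3] at hP hP'
  simp only [ρ_union_L] at heq
  rw [plane_eq_clF_trace hP.1 hP.2, plane_eq_clF_trace hP'.1 hP'.2, heq]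

/-- `Π_y ∩ G = L ∪ λ_y` (`Pi_inter_eq` with `ℓ ∩ G = L ∪ (ℓ ∩ ρ)` and `ℓ ∩ ρ ⊆ λ_y`). -/
theorem Pi_inter_G_eq (hs : Simple M) (hG : G ⊆ gr M) (h2 : 2 ≤ D.L.card) (y : α) :
    D.Pi y ∩ G = D.L ∪ D.lam y := by
  rw [Pi_inter_eq hs hG h2 y, ellF_inter_G_eq hs hG h2]
  ext z
  simp only [Finset.mem_union, Finset.mem_inter]
  constructor
  · rintro (hz | hz | ⟨hzℓ, hzρ⟩)
    · exact Or.inr hz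
    · exact Or.inl hz
    · exact Or.inr (mem_lam_of_mem_ellF hzℓ hzρ)
  · rintro (hz | hz)
    · exact Or.inr (Or.inl hz)
    · exact Or.inl hz

/-- A rank-`2` subset of `ρ` inside a plane is a non-class line trace candidate: it is `L′ ∩ ρ` for the line
`L′ = cl(P ∩ ρ)`. -/
theorem inter_ρ_mem_image_lines (hG : G ⊆ gr M) {P : Finset α} (hP : P ∈ planes M)
    (hr2 : M.eRk ((P ∩ D.ρ : Finset α) : Set α) = 2) :
    P ∩ D.ρ ∈ (lines M).image fun L' => L' ∩ D.ρ := by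
  have hsubG : P ∩ D.ρ ⊆ gr M := Finset.inter_subset_right.trans (D.ρ_subset.trans hG)
  obtain ⟨hL, hsub⟩ := clF_mem_lines hsubG hr2
  refine Finset.mem_image.2 ⟨clF M (P ∩ D.ρ), hL, ?_⟩
  apply Finset.Subset.antisymm
  · intro z hz
    rw [Finset.mem_inter] at hz ⊢
    refine ⟨?_, hz.2⟩
    have hcl : (clF M (P ∩ D.ρ) : Set α) ⊆ (P : Set α) := by
      rw [coe_clF]
      exact (M.closure_subset_closure (Finset.coe_subset.2 (Finset.inter_subset_left : P ∩ D.ρ ⊆ P))).trans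
        (mem_planes.1 hP).2.1.closure.subset
    exact_mod_cast hcl hz.1
  · intro z hz
    rw [Finset.mem_inter]
    exact ⟨hsub hz, (Finset.mem_inter.1 hz).2⟩

omit [DecidableEq α] [M.Finite] in
/-- `2 ≤ |X|` when `eRk X = 2`. -/
theorem two_le_card_of_eRk_eq_two {X : Finset α} (hr : M.eRk (X : Set α) = 2) : 2 ≤ X.card := by
  have := M.eRk_le_encard (X : Set α)
  rw [Set.encard_coe_eq_coe_finsetCard, hr] at this
  exact_mod_cast this

/-- The bridge term `hsub`: every rank-3-trace plane has its trace in the list `{ρ} ∪ {L ∪ λ_j} ∪ {{x} ∪ λ}`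
(`plane_trichotomy`). -/
theorem image_planes3_subset_tracesOf (hs : Simple M) (hG : G ⊆ gr M) (h2 : 2 ≤ D.L.card) :
    ((planes3 M G).image fun P => P ∩ (D.ρ ∪ D.L)) ⊆ tracesOf D.ρ D.L D.classes D.lineTraces := by
  intro T hT
  obtain ⟨P, hP, rfl⟩ := Finset.mem_image.1 hT
  rw [mem_planes3] at hP
  simp only [ρ_union_L]
  unfold tracesOf
  rw [Finset.mem_insert, Finset.mem_union]
  rcases plane_trichotomy hs hG h2 hP.1 hP.2 with h | ⟨y, hy, rfl⟩ | ⟨x, hxL, htr, hr2, hncl⟩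
  · left
    rw [h]
    rfl
  · right; left
    unfold piTraces
    exact Finset.mem_image.2 ⟨D.lam y, Finset.mem_image.2 ⟨y, hy, rfl⟩, (Pi_inter_G_eq hs hG h2 y).symm⟩
  · right; right
    unfold xlTraces
    refine Finset.mem_image.2 ⟨(x, P ∩ D.ρ), Finset.mem_product.2 ⟨hxL, ?_⟩, htr.symm⟩
    unfold lineTraces
    exact Finset.mem_filter.2 ⟨inter_ρ_mem_image_lines hG hP.1 hr2, two_le_card_of_eRk_eq_two hr2, hncl⟩

/-- A non-class line trace `l` determines its line: `cl(l) ∈ lines M` and `cl(l) ∩ ρ = l`. -/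
theorem clF_lineTrace (hs : Simple M) (hG : G ⊆ gr M) {l : Finset α} (hl : l ∈ D.lineTraces) :
    clF M l ∈ lines M ∧ clF M l ∩ D.ρ = l := by
  obtain ⟨hmem, h2l, -⟩ := Finset.mem_filter.1 hl
  obtain ⟨L', hL', rfl⟩ := Finset.mem_image.1 hmem
  have hsubG : L' ∩ D.ρ ⊆ gr M := Finset.inter_subset_right.trans (D.ρ_subset.trans hG)
  have hr2 : M.eRk ((L' ∩ D.ρ : Finset α) : Set α) = 2 :=
    eRk_eq_two_of_subset_line hs hL' Finset.inter_subset_left h2l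
  obtain ⟨hcl, hsub⟩ := clF_mem_lines hsubG hr2
  obtain ⟨a, ha, b, hb, hab⟩ := Finset.one_lt_card.1 (by omega : 1 < (L' ∩ D.ρ).card)
  have heq : clF M (L' ∩ D.ρ) = L' :=
    lines_eq_of_two_mem hs hcl hL' (hsub ha) (hsub hb) (Finset.mem_inter.1 ha).1 (Finset.mem_inter.1 hb).1 hab
  exact ⟨hcl, by rw [heq]⟩

/-- **The non-class line traces of size `m` number at most `ν_m`** (`#classes_m + #lineTraces_m ≤ inc_m`: the
classes and the non-class traces of size `m` map injectively, with disjoint images, into the lines meeting `ρ` in `m`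
points, by `l ↦ cl(l)`). -/
theorem card_lineTraces_le_nu (hs : Simple M) (hG : G ⊆ gr M) (hpl : ∀ P ∈ planes M, (P ∩ G).card ≤ 7)
    (hg : 10 ≤ G.card) (m : ℕ) (hm : 2 ≤ m) :
    (D.lineTraces.filter fun l => l.card = m).card ≤ PL.nu D.profile m := by
  have h2 : 2 ≤ D.L.card := by have := D.three_le_card_L (hpl _ D.plane) hg; omega
  have hp7 : D.ρ.card ≤ 7 := hpl _ D.plane
  have hCl : ∀ C ∈ D.classes.filter (fun C => m = C.card), clF M C ∈ lines M ∧ clF M C ∩ D.ρ = C :=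
    fun C hC => by
      rw [Finset.mem_filter] at hC
      exact class_line hs hG h2 hC.1 (by omega)
  have hNl : ∀ l ∈ D.lineTraces.filter (fun l => l.card = m), clF M l ∈ lines M ∧ clF M l ∩ D.ρ = l :=
    fun l hl => clF_lineTrace hs hG (Finset.mem_filter.1 hl).1
  have hinjC : Set.InjOn (fun C => clF M C) ↑(D.classes.filter fun C => m = C.card) :=
    fun C hC C' hC' heq => by
      simp only at heq
      rw [← (hCl C hC).2, ← (hCl C' hC').2, heq]
  have hinjN : Set.InjOn (fun l => clF M l) ↑(D.lineTraces.filter fun l => l.card = m) :=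
    fun l hl l' hl' heq => by
      simp only at heq
      rw [← (hNl l hl).2, ← (hNl l' hl').2, heq]
  have hdisj : Disjoint ((D.classes.filter fun C => m = C.card).image fun C => clF M C)
      ((D.lineTraces.filter fun l => l.card = m).image fun l => clF M l) := by
    rw [Finset.disjoint_left]
    intro X hX hX'
    obtain ⟨C, hC, rfl⟩ := Finset.mem_image.1 hX
    obtain ⟨l, hl, heq⟩ := Finset.mem_image.1 hX'
    have hlC : l = C := by rw [← (hNl l hl).2, ← (hCl C hC).2, heq]
    have hl' := (Finset.mem_filter.1 (Finset.mem_filter.1 hl).1).2.2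
    exact hl' (hlC ▸ (Finset.mem_filter.1 hC).1)
  have hsub : ((D.classes.filter fun C => m = C.card).image fun C => clF M C) ∪
      ((D.lineTraces.filter fun l => l.card = m).image fun l => clF M l) ⊆
      (lines M).filter fun L : Finset α => (L ∩ D.ρ).card = m := by
    intro X hX
    rw [Finset.mem_union] at hX
    rcases hX with hX | hX
    · obtain ⟨C, hC, rfl⟩ := Finset.mem_image.1 hX
      have := hCl C hC
      rw [Finset.mem_filter, this.2]
      exact ⟨this.1, (Finset.mem_filter.1 hC).2.symm⟩
    · obtain ⟨l, hl, rfl⟩ := Finset.mem_image.1 hX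
      have := hNl l hl
      rw [Finset.mem_filter, this.2]
      exact ⟨this.1, (Finset.mem_filter.1 hl).2⟩
  have hcard := Finset.card_le_card hsub
  rw [Finset.card_union_of_disjoint hdisj, Finset.card_image_of_injOn hinjC,
    Finset.card_image_of_injOn hinjN] at hcard
  have hcnt : D.profile.sizes.count m = (D.classes.filter fun C => m = C.card).card := sizes_count m
  have hinc : PL.incOf D.profile m = ((lines M).filter fun L : Finset α => (L ∩ D.ρ).card = m).card := by
    rcases Nat.lt_or_ge m 8 with hm8 | hm8
    · unfold PL.incOf
      rw [if_pos hm, inc_profile _ (by omega), show m - 2 + 2 = m by omega]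
      rfl
    · have h0 : ((lines M).filter fun L : Finset α => (L ∩ D.ρ).card = m).card = 0 := by
        rw [Finset.card_eq_zero, Finset.filter_eq_empty_iff]
        intro L _ hL
        have := Finset.card_le_card (Finset.inter_subset_right : L ∩ D.ρ ⊆ D.ρ)
        omega
      rw [h0]
      unfold PL.incOf
      rw [if_pos hm]
      show ((List.range 6).map fun i => inc M D.ρ (i + 2)).getD (m - 2) 0 = 0
      rw [List.getD_eq_getElem?_getD, List.getElem?_eq_none (by simp; omega)]
      rfl
  show (D.lineTraces.filter fun l => l.card = m).card ≤ PL.incOf D.profile m - D.profile.sizes.count m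
  rw [hinc, hcnt]
  exact Nat.le_sub_of_add_le (by rw [Nat.add_comm]; exact hcard)

/-- **Step (4) on the matroid side**: `X ≤ X̄(profile D)` for every normalisation `D` (`g ≥ 10`). -/
theorem Xcnt_le_Xbar_profile (hs : Simple M) (hG : G ⊆ gr M) (hr : M.eRk (G : Set α) = 4)
    (hpl : ∀ P ∈ planes M, (P ∩ G).card ≤ 7) (hg : 10 ≤ G.card) :
    Xcnt M G ≤ PL.Xbar D.profile :=
  have h2 : 2 ≤ D.L.card := by have := D.three_le_card_L (hpl _ D.plane) hg; omega
  Xcnt_le_Xbar_seam D.ρ_union_L.symm hG hr (D.traceData hs hG hpl hg) D.injOn_planes3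
    (D.image_planes3_subset_tracesOf hs hG h2)

end PLData

end PercRepro.SixFour
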